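import Summits.Parity.GeneralizedHardyLittlewood.Theorems.PrimeLevelFamEdgeMomentsBeyondDiagonalDiagDecorOrderOneThreeHecke
import Summits.Parity.GeneralizedHardyLittlewood.Theorems.PrimeLevelFamEdgeMomentsBeyondDiagonalDiagDecorOrderTwoTwoPoly
import Summits.Parity.GeneralizedHardyLittlewood.Theorems.PrimeLevelFamEdgeMomentsBeyondDiagonalDiagDecorM4Family
import HarnessLib

/-!
# Route `PrimeLevelFamEdge`, crux K_A `MomentsBeyondDiagonal` (stmt-Parity-20007), line «petersson_layers» v4, stub `stub_diag`:
# **(Poly₁₃) IS UNCONDITIONAL: the polynomial part of the order-`(1,3)` target from the sixteen landed engine instances**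

The polynomial weight of order `(1,3)` (`…DiagDecorOrderOneThreeHecke.selbergOrderOneThree_split`) is the sum of sixteen
monomials: `ττL^m` (`m ≤ 5`, `…DiagDecorShiftedLpow.abs_selbergLpow_sub_le`), `τP₂·τ·L^m` and mirror (`m ≤ 1` only,
`…DiagDecorShiftedP2Lpow.abs_selbergP2Lpow_sub_le(')`), `τP₂·τP₂·L^m` (`m ≤ 1`, `…DiagDecorShiftedP2P2Lpow.abs_selbergP2P2Lpow_sub_le`)
and the four `M₄ = τ(3P₂² − 2P₄)`-decorated ones (`m ≤ 1`, `…DiagDecorM4Family.M4_bounds`, lineage famedge-2 g5). Only `ττL⁵/160`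
and `−(3/16)τP₂τP₂L` reach the main order `log²M` — unlike order `(2,2)` there is no `τP₂·τ·L³` piece (its coefficient
`−3/16 + 3/16 = 0` cancels between `c₀₁` and `c₁₀`/`c₀₂`/`c₁₁`).

* `orderOneThree_combine` — the linear bookkeeping (reusing `…DiagDecorOrderTwoTwoCombine.poly22_piece_*`);
* `abs_selbergOrderOneThreePoly_sub_le` — **`|Sel(poly₁₃)(M) − (π²/6)²(Φ₅/160 − (3/16)Ξ₁)(λ,P)·log²M| ≤ C·log M`**
  (`0 ≤ λ ≤ 1`, `P₀ = P₁ = 0`, arbitrary `E_ab, μ₂, μ₄`, `M ≥ 3`);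
* `orderOneThreePoly` — the same in the exact hypothesis shape (Poly₁₃) of
  `…DiagDecorOrderOneThreeAssembly.orderOneThree_target_of_poly_of_remainder`.

Def-free; theorems only. Helper `--supports stmt-Parity-20007`; closes nothing; K_A, K_B and the Parity summit are NOT proved;
nothing about Landau–Siegel zeros.

## References
* E. Kowalski, P. Michel, J. VanderKam, J. reine angew. Math. 526 (2000), (23)–(28) pp. 13–15 and Prop. 5.1 p. 18.
  [cite: KowalskiMichelVanderKam2000, (23)–(28) — derivation (order-(1,3) piece of the diagonal main term, general Q)]
-/

noncomputable section

open scoped Real ArithmeticFunction.Moebius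
open Literature.NumberTheory.LFunctions Literature.NumberTheory.LFunctions.KMV2000
open Literature.NumberTheory.Sieve (one_le_log_of_three_le)
open Finset ArithmeticFunction Polynomial MeasureTheory Set

namespace Summit.Parity.GeneralizedHardyLittlewood.Theorems.MomentsBeyondDiagonal.DiagKernel

open Literature.NumberTheory.LFunctions Literature.NumberTheory.LFunctions.KMV2000

/-! ### Bookkeeping -/

/-- **The bookkeeping of the sixteen pieces at order `(1,3)`** (`K = (π²/6)²`, `ℓ = log M ≥ 1`): two top-degree pieces
(`S₅`, `U₁`) carry the main term `K(Φ₅/160 − (3/16)Ξ₁)ℓ²` (there is NO `τP₂·τ·L³` piece at this order), the other fourteen are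
`O(ℓ)`. [folklore] -/
theorem orderOneThree_combine
    {S₅ S₄ S₃ S₂ S₁ S₀ T₁ T₀ T₁' T₀' U₁ U₀ V₁ V₀ W₁ W₀ : ℝ}
    {Φ₅ Φ₄ Φ₃ Φ₂ Φ₁ Φ₀ Ψ₁ Ψ₀ Ψ₁' Ψ₀' Ξ₁ Ξ₀ : ℝ}
    {C₅ C₄ C₃ C₂ C₁ C₀ D₁ D₀ D₁' D₀' G₁ G₀ A₁ A₀ B₁ B₀ : ℝ}
    {E₀₀ E₀₁ E₀₂ E₀₃ E₁₀ E₁₁ E₁₂ E₁₃ μ₂ μ₄ ℓ K : ℝ} (hℓ : 1 ≤ ℓ) (hK : 0 ≤ K)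
    (hC₄ : 0 ≤ C₄) (hC₃ : 0 ≤ C₃) (hC₂ : 0 ≤ C₂) (hC₁ : 0 ≤ C₁) (hC₀ : 0 ≤ C₀) (hD₁ : 0 ≤ D₁) (hD₀ : 0 ≤ D₀) (hD₁' : 0 ≤ D₁') (hD₀' : 0 ≤ D₀') (hG₀ : 0 ≤ G₀)
    (h5 : |S₅ - K * Φ₅ * ℓ ^ 5 * ℓ / ℓ ^ 4| ≤ C₅ * ℓ ^ 5 / ℓ ^ 4)
    (h4 : |S₄ - K * Φ₄ * ℓ ^ 4 * ℓ / ℓ ^ 4| ≤ C₄ * ℓ ^ 4 / ℓ ^ 4)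
    (h3 : |S₃ - K * Φ₃ * ℓ ^ 3 * ℓ / ℓ ^ 4| ≤ C₃ * ℓ ^ 3 / ℓ ^ 4)
    (h2 : |S₂ - K * Φ₂ * ℓ ^ 2 * ℓ / ℓ ^ 4| ≤ C₂ * ℓ ^ 2 / ℓ ^ 4)
    (h1 : |S₁ - K * Φ₁ * ℓ ^ 1 * ℓ / ℓ ^ 4| ≤ C₁ * ℓ ^ 1 / ℓ ^ 4)
    (h0 : |S₀ - K * Φ₀ * ℓ ^ 0 * ℓ / ℓ ^ 4| ≤ C₀ * ℓ ^ 0 / ℓ ^ 4)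
    (g1 : |T₁ - K * Ψ₁ * ℓ ^ 1 * ℓ / ℓ ^ 2| ≤ D₁ * ℓ ^ 1 / ℓ ^ 2)
    (g0 : |T₀ - K * Ψ₀ * ℓ ^ 0 * ℓ / ℓ ^ 2| ≤ D₀ * ℓ ^ 0 / ℓ ^ 2)
    (g1p : |T₁' - K * Ψ₁' * ℓ ^ 1 * ℓ / ℓ ^ 2| ≤ D₁' * ℓ ^ 1 / ℓ ^ 2)
    (g0p : |T₀' - K * Ψ₀' * ℓ ^ 0 * ℓ / ℓ ^ 2| ≤ D₀' * ℓ ^ 0 / ℓ ^ 2)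
    (u1 : |U₁ - K * Ξ₁ * ℓ ^ 1 * ℓ / ℓ ^ 0| ≤ G₁ * ℓ ^ 1 / ℓ ^ 0)
    (u0 : |U₀ - K * Ξ₀ * ℓ ^ 0 * ℓ / ℓ ^ 0| ≤ G₀ * ℓ ^ 0 / ℓ ^ 0)
    (a1 : |V₁| ≤ A₁ * ℓ)
    (a0 : |V₀| ≤ A₀ * ℓ)
    (b1 : |W₁| ≤ B₁ * ℓ)
    (b0 : |W₀| ≤ B₀ * ℓ) :
    |((1 / 160) * S₅ +
        (E₀₀ / 16) * S₄ +
        (3 * E₀₁ / 8 + E₁₀ / 8) * S₃ +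
        (3 * E₀₂ / 4 + 3 * E₁₁ / 4) * S₂ +
        (E₀₃ / 2 + 3 * E₁₂ / 2 - 2 * μ₄) * S₁ +
        E₁₃ * S₀ +
        (-3 * E₀₁ / 8 + 3 * E₁₀ / 8 - 3 * μ₂) * T₁ +
        (-3 * E₀₂ / 4 + 3 * E₁₁ / 4) * T₀ +
        (-3 * E₀₁ / 8 + 3 * E₁₀ / 8 - 3 * μ₂) * T₁' +
        (-3 * E₀₂ / 4 + 3 * E₁₁ / 4) * T₀' +
        (-3 / 16) * U₁ +
        (-3 * E₀₀ / 8) * U₀ +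
        (-1 / 32) * V₁ +
        (-E₀₀ / 16) * V₀ +
        (-1 / 32) * W₁ +
        (-E₀₀ / 16) * W₀) -
        K * (Φ₅ / 160 - 3 / 16 * Ξ₁) * ℓ ^ 2| ≤
      (|((1 / 160) : ℝ)| * C₅ +
        |((E₀₀ / 16) : ℝ)| * (K * |Φ₄| + C₄) +
        |((3 * E₀₁ / 8 + E₁₀ / 8) : ℝ)| * (K * |Φ₃| + C₃) +
        |((3 * E₀₂ / 4 + 3 * E₁₁ / 4) : ℝ)| * (K * |Φ₂| + C₂) +
        |((E₀₃ / 2 + 3 * E₁₂ / 2 - 2 * μ₄) : ℝ)| * (K * |Φ₁| + C₁) +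
        |(E₁₃ : ℝ)| * (K * |Φ₀| + C₀) +
        |((-3 * E₀₁ / 8 + 3 * E₁₀ / 8 - 3 * μ₂) : ℝ)| * (K * |Ψ₁| + D₁) +
        |((-3 * E₀₂ / 4 + 3 * E₁₁ / 4) : ℝ)| * (K * |Ψ₀| + D₀) +
        |((-3 * E₀₁ / 8 + 3 * E₁₀ / 8 - 3 * μ₂) : ℝ)| * (K * |Ψ₁'| + D₁') +
        |((-3 * E₀₂ / 4 + 3 * E₁₁ / 4) : ℝ)| * (K * |Ψ₀'| + D₀') +
        |((-3 / 16) : ℝ)| * G₁ +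
        |((-3 * E₀₀ / 8) : ℝ)| * (K * |Ξ₀| + G₀) +
        |((-1 / 32) : ℝ)| * A₁ +
        |((-E₀₀ / 16) : ℝ)| * A₀ +
        |((-1 / 32) : ℝ)| * B₁ +
        |((-E₀₀ / 16) : ℝ)| * B₀) * ℓ := by
  have q1 := poly22_piece_main ((1 / 160) : ℝ) hℓ rfl h5
  have q2 := poly22_piece_low ((E₀₀ / 16) : ℝ) hℓ hK hC₄ (by norm_num) h4
  have q3 := poly22_piece_low ((3 * E₀₁ / 8 + E₁₀ / 8) : ℝ) hℓ hK hC₃ (by norm_num) h3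
  have q4 := poly22_piece_low ((3 * E₀₂ / 4 + 3 * E₁₁ / 4) : ℝ) hℓ hK hC₂ (by norm_num) h2
  have q5 := poly22_piece_low ((E₀₃ / 2 + 3 * E₁₂ / 2 - 2 * μ₄) : ℝ) hℓ hK hC₁ (by norm_num) h1
  have q6 := poly22_piece_low (E₁₃ : ℝ) hℓ hK hC₀ (by norm_num) h0
  have q7 := poly22_piece_low ((-3 * E₀₁ / 8 + 3 * E₁₀ / 8 - 3 * μ₂) : ℝ) hℓ hK hD₁ (by norm_num) g1
  have q8 := poly22_piece_low ((-3 * E₀₂ / 4 + 3 * E₁₁ / 4) : ℝ) hℓ hK hD₀ (by norm_num) g0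
  have q9 := poly22_piece_low ((-3 * E₀₁ / 8 + 3 * E₁₀ / 8 - 3 * μ₂) : ℝ) hℓ hK hD₁' (by norm_num) g1p
  have q10 := poly22_piece_low ((-3 * E₀₂ / 4 + 3 * E₁₁ / 4) : ℝ) hℓ hK hD₀' (by norm_num) g0p
  have q11 := poly22_piece_main ((-3 / 16) : ℝ) hℓ rfl u1
  have q12 := poly22_piece_low ((-3 * E₀₀ / 8) : ℝ) hℓ hK hG₀ (by norm_num) u0
  have q13 := poly22_piece_hyp ((-1 / 32) : ℝ) a1
  have q14 := poly22_piece_hyp ((-E₀₀ / 16) : ℝ) a0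
  have q15 := poly22_piece_hyp ((-1 / 32) : ℝ) b1
  have q16 := poly22_piece_hyp ((-E₀₀ / 16) : ℝ) b0
  have H2 := poly22_add_piece q1 q2
  have H3 := poly22_add_piece H2 q3
  have H4 := poly22_add_piece H3 q4
  have H5 := poly22_add_piece H4 q5
  have H6 := poly22_add_piece H5 q6
  have H7 := poly22_add_piece H6 q7
  have H8 := poly22_add_piece H7 q8
  have H9 := poly22_add_piece H8 q9
  have H10 := poly22_add_piece H9 q10
  have H11 := poly22_add_piece H10 q11
  have H12 := poly22_add_piece H11 q12
  have H13 := poly22_add_piece H12 q13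
  have H14 := poly22_add_piece H13 q14
  have H15 := poly22_add_piece H14 q15
  have H16 := poly22_add_piece H15 q16
  have hm : ∀ {x m₁ m₂ d : ℝ}, m₁ = m₂ → |x - m₁| ≤ d → |x - m₂| ≤ d := fun e h ↦ e ▸ h
  refine (hm ?_ H16).trans (le_of_eq ?_)
  · ring
  · ring

/-! ### The polynomial part of order `(1,3)` -/

/-- **(Poly₁₃), UNCONDITIONALLY**: for `0 ≤ λ ≤ 1`, `P₀ = P₁ = 0`, arbitrary reals `E_ab, μ₂, μ₄`, there is `C` with
`|Sel(poly₁₃)(M) − (π²/6)²(Φ₅/160 − (3/16)Ξ₁)(λ,P)·log²M| ≤ C·log M` for all `M ≥ 3` — the sixteen landed engine instances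
(`…ShiftedLpow` `m ≤ 5`, `…ShiftedP2Lpow(')` `m ≤ 1`, `…ShiftedP2P2Lpow` `m ≤ 1`, `…DiagDecorM4Family.M4_bounds` `m ≤ 1`).
[cite: KowalskiMichelVanderKam2000, (23)–(28) and Prop. 5.1 — derivation (order-(1,3) piece of the diagonal main term)] -/
theorem abs_selbergOrderOneThreePoly_sub_le (P : ℝ[X]) (hP0 : P.coeff 0 = 0) (hP1 : P.coeff 1 = 0)
    {lam : ℝ} (hlam0 : 0 ≤ lam) (hlam1 : lam ≤ 1) (E₀₀ E₀₁ E₀₂ E₀₃ E₁₀ E₁₁ E₁₂ E₁₃ μ₂ μ₄ : ℝ) :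
    ∃ C : ℝ, ∀ M : ℝ, 3 ≤ M →
      |∑ c ∈ Icc 1 ⌊M⌋₊, ∑ g ∈ Icc 1 (⌊M⌋₊ / c), (μ g : ℝ) * c *
        ∑ k₁ ∈ Icc 1 (⌊M⌋₊ / (c * g)), ∑ k₂ ∈ Icc 1 (⌊M⌋₊ / (c * g)),
          ((μ (c * g * k₁) : ℝ) * ((psi (c * g * k₁))⁻¹ *
              P.eval (Real.log (M / ((c * g * k₁ : ℕ) : ℝ)) / Real.log M)) / ((c * g * k₁ : ℕ) : ℝ)) *
            ((μ (c * g * k₂) : ℝ) * ((psi (c * g * k₂))⁻¹ *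
              P.eval (Real.log (M / ((c * g * k₂ : ℕ) : ℝ)) / Real.log M)) / ((c * g * k₂ : ℕ) : ℝ)) *
            ((1 / 160) * ((k₁.divisors.card : ℝ) * (k₂.divisors.card : ℝ) *
                (2 * (lam * Real.log M) - 2 * Real.log g - Real.log k₁ - Real.log k₂) ^ 5) +
              (E₀₀ / 16) * ((k₁.divisors.card : ℝ) * (k₂.divisors.card : ℝ) *
                (2 * (lam * Real.log M) - 2 * Real.log g - Real.log k₁ - Real.log k₂) ^ 4) +
              (3 * E₀₁ / 8 + E₁₀ / 8) * ((k₁.divisors.card : ℝ) * (k₂.divisors.card : ℝ) *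
                (2 * (lam * Real.log M) - 2 * Real.log g - Real.log k₁ - Real.log k₂) ^ 3) +
              (3 * E₀₂ / 4 + 3 * E₁₁ / 4) * ((k₁.divisors.card : ℝ) * (k₂.divisors.card : ℝ) *
                (2 * (lam * Real.log M) - 2 * Real.log g - Real.log k₁ - Real.log k₂) ^ 2) +
              (E₀₃ / 2 + 3 * E₁₂ / 2 - 2 * μ₄) * ((k₁.divisors.card : ℝ) * (k₂.divisors.card : ℝ) *
                (2 * (lam * Real.log M) - 2 * Real.log g - Real.log k₁ - Real.log k₂) ^ 1) +
              E₁₃ * ((k₁.divisors.card : ℝ) * (k₂.divisors.card : ℝ) *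
                (2 * (lam * Real.log M) - 2 * Real.log g - Real.log k₁ - Real.log k₂) ^ 0) +
              (-3 * E₀₁ / 8 + 3 * E₁₀ / 8 - 3 * μ₂) * ((k₁.divisors.card : ℝ) * (∑ p ∈ k₁.primeFactors, Real.log p ^ 2) * (k₂.divisors.card : ℝ) *
                (2 * (lam * Real.log M) - 2 * Real.log g - Real.log k₁ - Real.log k₂) ^ 1) +
              (-3 * E₀₂ / 4 + 3 * E₁₁ / 4) * ((k₁.divisors.card : ℝ) * (∑ p ∈ k₁.primeFactors, Real.log p ^ 2) * (k₂.divisors.card : ℝ) *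
                (2 * (lam * Real.log M) - 2 * Real.log g - Real.log k₁ - Real.log k₂) ^ 0) +
              (-3 * E₀₁ / 8 + 3 * E₁₀ / 8 - 3 * μ₂) * ((k₁.divisors.card : ℝ) * ((k₂.divisors.card : ℝ) * ∑ p ∈ k₂.primeFactors, Real.log p ^ 2) *
                (2 * (lam * Real.log M) - 2 * Real.log g - Real.log k₁ - Real.log k₂) ^ 1) +
              (-3 * E₀₂ / 4 + 3 * E₁₁ / 4) * ((k₁.divisors.card : ℝ) * ((k₂.divisors.card : ℝ) * ∑ p ∈ k₂.primeFactors, Real.log p ^ 2) *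
                (2 * (lam * Real.log M) - 2 * Real.log g - Real.log k₁ - Real.log k₂) ^ 0) +
              (-3 / 16) * ((k₁.divisors.card : ℝ) * (∑ p ∈ k₁.primeFactors, Real.log p ^ 2) *
                ((k₂.divisors.card : ℝ) * (∑ p ∈ k₂.primeFactors, Real.log p ^ 2)) *
                (2 * (lam * Real.log M) - 2 * Real.log g - Real.log k₁ - Real.log k₂) ^ 1) +
              (-3 * E₀₀ / 8) * ((k₁.divisors.card : ℝ) * (∑ p ∈ k₁.primeFactors, Real.log p ^ 2) *
                ((k₂.divisors.card : ℝ) * (∑ p ∈ k₂.primeFactors, Real.log p ^ 2)) *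
                (2 * (lam * Real.log M) - 2 * Real.log g - Real.log k₁ - Real.log k₂) ^ 0) +
              (-1 / 32) * ((k₁.divisors.card : ℝ) * (3 * (∑ p ∈ k₁.primeFactors, Real.log p ^ 2) ^ 2 - 2 * ∑ p ∈ k₁.primeFactors, Real.log p ^ 4) *
                (k₂.divisors.card : ℝ) * (2 * (lam * Real.log M) - 2 * Real.log g - Real.log k₁ - Real.log k₂) ^ 1) +
              (-E₀₀ / 16) * ((k₁.divisors.card : ℝ) * (3 * (∑ p ∈ k₁.primeFactors, Real.log p ^ 2) ^ 2 - 2 * ∑ p ∈ k₁.primeFactors, Real.log p ^ 4) *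
                (k₂.divisors.card : ℝ) * (2 * (lam * Real.log M) - 2 * Real.log g - Real.log k₁ - Real.log k₂) ^ 0) +
              (-1 / 32) * ((k₁.divisors.card : ℝ) * ((k₂.divisors.card : ℝ) *
                (3 * (∑ p ∈ k₂.primeFactors, Real.log p ^ 2) ^ 2 - 2 * ∑ p ∈ k₂.primeFactors, Real.log p ^ 4)) *
                (2 * (lam * Real.log M) - 2 * Real.log g - Real.log k₁ - Real.log k₂) ^ 1) +
              (-E₀₀ / 16) * ((k₁.divisors.card : ℝ) * ((k₂.divisors.card : ℝ) *
                (3 * (∑ p ∈ k₂.primeFactors, Real.log p ^ 2) ^ 2 - 2 * ∑ p ∈ k₂.primeFactors, Real.log p ^ 4)) *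
                (2 * (lam * Real.log M) - 2 * Real.log g - Real.log k₁ - Real.log k₂) ^ 0)) -
        (π ^ 2 / 6) ^ 2 * ((∑ j ∈ Finset.range (5 + 1), ∑ i ∈ Finset.range (j + 1),
            ((5 : ℕ).choose j : ℝ) * (j.choose i : ℝ) * 2 ^ (5 - j) *
              ∫ u in (0 : ℝ)..1, (((Polynomial.C lam - X) ^ (5 - j) * derivative (derivative (X ^ i * P))) *
                derivative (derivative (X ^ (j - i) * P))).eval u) / 160 -
          3 / 16 * (∑ j ∈ Finset.range (1 + 1), ∑ i ∈ Finset.range (j + 1),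
            ((1 : ℕ).choose j : ℝ) * (j.choose i : ℝ) * 2 ^ (1 - j) *
              ∫ u in (0 : ℝ)..1, (((Polynomial.C lam - X) ^ (1 - j) * (-(2 : ℝ) • (X ^ i * P))) *
                (-(2 : ℝ) • (X ^ (j - i) * P))).eval u)) * Real.log M ^ 2| ≤ C * Real.log M := by
  obtain ⟨C5, hC5, h5⟩ := abs_selbergLpow_sub_le P hP0 hP1 5 hlam0 hlam1
  obtain ⟨C4, hC4, h4⟩ := abs_selbergLpow_sub_le P hP0 hP1 4 hlam0 hlam1
  obtain ⟨C3, hC3, h3⟩ := abs_selbergLpow_sub_le P hP0 hP1 3 hlam0 hlam1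
  obtain ⟨C2, hC2, h2⟩ := abs_selbergLpow_sub_le P hP0 hP1 2 hlam0 hlam1
  obtain ⟨C1, hC1, h1⟩ := abs_selbergLpow_sub_le P hP0 hP1 1 hlam0 hlam1
  obtain ⟨C0, hC0, h0⟩ := abs_selbergLpow_sub_le P hP0 hP1 0 hlam0 hlam1
  obtain ⟨D1, hD1, g1⟩ := abs_selbergP2Lpow_sub_le P hP0 hP1 1 hlam0 hlam1
  obtain ⟨D0, hD0, g0⟩ := abs_selbergP2Lpow_sub_le P hP0 hP1 0 hlam0 hlam1
  obtain ⟨D1', hD1', g1p⟩ := abs_selbergP2Lpow_sub_le' P hP0 hP1 1 hlam0 hlam1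
  obtain ⟨D0', hD0', g0p⟩ := abs_selbergP2Lpow_sub_le' P hP0 hP1 0 hlam0 hlam1
  obtain ⟨G1, hG1, u1⟩ := abs_selbergP2P2Lpow_sub_le P hP0 hP1 1 hlam0 hlam1
  obtain ⟨G0, hG0, u0⟩ := abs_selbergP2P2Lpow_sub_le P hP0 hP1 0 hlam0 hlam1
  obtain ⟨A1, a1⟩ := (M4_bounds P hP0 hP1 lam hlam0 hlam1 1 (by norm_num)).1
  obtain ⟨A0, a0⟩ := (M4_bounds P hP0 hP1 lam hlam0 hlam1 0 (by norm_num)).1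
  obtain ⟨B1, b1⟩ := (M4_bounds P hP0 hP1 lam hlam0 hlam1 1 (by norm_num)).2
  obtain ⟨B0, b0⟩ := (M4_bounds P hP0 hP1 lam hlam0 hlam1 0 (by norm_num)).2
  have hK : 0 ≤ (π ^ 2 / 6 : ℝ) ^ 2 := by positivity
  refine ⟨?_, fun M hM ↦ ?_⟩
  swap
  · have hℓ1 : 1 ≤ Real.log M := one_le_log_of_three_le hM
    simp only [selbergProd_add, selbergProd_const_mul]
    exact orderOneThree_combine (E₀₀ := E₀₀) (E₀₁ := E₀₁) (E₀₂ := E₀₂) (E₀₃ := E₀₃) (E₁₀ := E₁₀) (E₁₁ := E₁₁) (E₁₂ := E₁₂) (E₁₃ := E₁₃) (μ₂ := μ₂) (μ₄ := μ₄) hℓ1 hK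
      hC4.le hC3.le hC2.le hC1.le hC0.le hD1.le hD0.le hD1'.le hD0'.le hG0.le
      (h5 M hM) (h4 M hM) (h3 M hM) (h2 M hM) (h1 M hM) (h0 M hM) (g1 M hM) (g0 M hM) (g1p M hM) (g0p M hM) (u1 M hM) (u0 M hM) (a1 M hM) (a0 M hM) (b1 M hM) (b0 M hM)

/-- **(Poly₁₃) in the exact hypothesis shape of `…DiagDecorOrderOneThreeAssembly.orderOneThree_target_of_poly_of_remainder`**
(`𝔎(λ,P) = (π²/6)²(Φ₅/160 − (3/16)Ξ₁)`), for every `P`, `λ`. [cite: KowalskiMichelVanderKam2000, (23)–(28) and Prop. 5.1 — derivation] -/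
theorem orderOneThreePoly :
    ∀ P : ℝ[X], P.coeff 0 = 0 → P.coeff 1 = 0 → ∀ lam : ℝ, 0 ≤ lam → lam ≤ 1 →
      ∀ E₀₀ E₀₁ E₀₂ E₀₃ E₁₀ E₁₁ E₁₂ E₁₃ μ₂ μ₄ : ℝ, ∃ C : ℝ, ∀ M : ℝ, 3 ≤ M →
      |∑ c ∈ Icc 1 ⌊M⌋₊, ∑ g ∈ Icc 1 (⌊M⌋₊ / c), (μ g : ℝ) * c *
        ∑ k₁ ∈ Icc 1 (⌊M⌋₊ / (c * g)), ∑ k₂ ∈ Icc 1 (⌊M⌋₊ / (c * g)),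
          ((μ (c * g * k₁) : ℝ) * ((psi (c * g * k₁))⁻¹ *
              P.eval (Real.log (M / ((c * g * k₁ : ℕ) : ℝ)) / Real.log M)) / ((c * g * k₁ : ℕ) : ℝ)) *
            ((μ (c * g * k₂) : ℝ) * ((psi (c * g * k₂))⁻¹ *
              P.eval (Real.log (M / ((c * g * k₂ : ℕ) : ℝ)) / Real.log M)) / ((c * g * k₂ : ℕ) : ℝ)) *
            ((1 / 160) * ((k₁.divisors.card : ℝ) * (k₂.divisors.card : ℝ) *
                (2 * (lam * Real.log M) - 2 * Real.log g - Real.log k₁ - Real.log k₂) ^ 5) +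
              (E₀₀ / 16) * ((k₁.divisors.card : ℝ) * (k₂.divisors.card : ℝ) *
                (2 * (lam * Real.log M) - 2 * Real.log g - Real.log k₁ - Real.log k₂) ^ 4) +
              (3 * E₀₁ / 8 + E₁₀ / 8) * ((k₁.divisors.card : ℝ) * (k₂.divisors.card : ℝ) *
                (2 * (lam * Real.log M) - 2 * Real.log g - Real.log k₁ - Real.log k₂) ^ 3) +
              (3 * E₀₂ / 4 + 3 * E₁₁ / 4) * ((k₁.divisors.card : ℝ) * (k₂.divisors.card : ℝ) *
                (2 * (lam * Real.log M) - 2 * Real.log g - Real.log k₁ - Real.log k₂) ^ 2) +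
              (E₀₃ / 2 + 3 * E₁₂ / 2 - 2 * μ₄) * ((k₁.divisors.card : ℝ) * (k₂.divisors.card : ℝ) *
                (2 * (lam * Real.log M) - 2 * Real.log g - Real.log k₁ - Real.log k₂) ^ 1) +
              E₁₃ * ((k₁.divisors.card : ℝ) * (k₂.divisors.card : ℝ) *
                (2 * (lam * Real.log M) - 2 * Real.log g - Real.log k₁ - Real.log k₂) ^ 0) +
              (-3 * E₀₁ / 8 + 3 * E₁₀ / 8 - 3 * μ₂) * ((k₁.divisors.card : ℝ) * (∑ p ∈ k₁.primeFactors, Real.log p ^ 2) * (k₂.divisors.card : ℝ) *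
                (2 * (lam * Real.log M) - 2 * Real.log g - Real.log k₁ - Real.log k₂) ^ 1) +
              (-3 * E₀₂ / 4 + 3 * E₁₁ / 4) * ((k₁.divisors.card : ℝ) * (∑ p ∈ k₁.primeFactors, Real.log p ^ 2) * (k₂.divisors.card : ℝ) *
                (2 * (lam * Real.log M) - 2 * Real.log g - Real.log k₁ - Real.log k₂) ^ 0) +
              (-3 * E₀₁ / 8 + 3 * E₁₀ / 8 - 3 * μ₂) * ((k₁.divisors.card : ℝ) * ((k₂.divisors.card : ℝ) * ∑ p ∈ k₂.primeFactors, Real.log p ^ 2) *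
                (2 * (lam * Real.log M) - 2 * Real.log g - Real.log k₁ - Real.log k₂) ^ 1) +
              (-3 * E₀₂ / 4 + 3 * E₁₁ / 4) * ((k₁.divisors.card : ℝ) * ((k₂.divisors.card : ℝ) * ∑ p ∈ k₂.primeFactors, Real.log p ^ 2) *
                (2 * (lam * Real.log M) - 2 * Real.log g - Real.log k₁ - Real.log k₂) ^ 0) +
              (-3 / 16) * ((k₁.divisors.card : ℝ) * (∑ p ∈ k₁.primeFactors, Real.log p ^ 2) *
                ((k₂.divisors.card : ℝ) * (∑ p ∈ k₂.primeFactors, Real.log p ^ 2)) *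
                (2 * (lam * Real.log M) - 2 * Real.log g - Real.log k₁ - Real.log k₂) ^ 1) +
              (-3 * E₀₀ / 8) * ((k₁.divisors.card : ℝ) * (∑ p ∈ k₁.primeFactors, Real.log p ^ 2) *
                ((k₂.divisors.card : ℝ) * (∑ p ∈ k₂.primeFactors, Real.log p ^ 2)) *
                (2 * (lam * Real.log M) - 2 * Real.log g - Real.log k₁ - Real.log k₂) ^ 0) +
              (-1 / 32) * ((k₁.divisors.card : ℝ) * (3 * (∑ p ∈ k₁.primeFactors, Real.log p ^ 2) ^ 2 - 2 * ∑ p ∈ k₁.primeFactors, Real.log p ^ 4) *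
                (k₂.divisors.card : ℝ) * (2 * (lam * Real.log M) - 2 * Real.log g - Real.log k₁ - Real.log k₂) ^ 1) +
              (-E₀₀ / 16) * ((k₁.divisors.card : ℝ) * (3 * (∑ p ∈ k₁.primeFactors, Real.log p ^ 2) ^ 2 - 2 * ∑ p ∈ k₁.primeFactors, Real.log p ^ 4) *
                (k₂.divisors.card : ℝ) * (2 * (lam * Real.log M) - 2 * Real.log g - Real.log k₁ - Real.log k₂) ^ 0) +
              (-1 / 32) * ((k₁.divisors.card : ℝ) * ((k₂.divisors.card : ℝ) *
                (3 * (∑ p ∈ k₂.primeFactors, Real.log p ^ 2) ^ 2 - 2 * ∑ p ∈ k₂.primeFactors, Real.log p ^ 4)) *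
                (2 * (lam * Real.log M) - 2 * Real.log g - Real.log k₁ - Real.log k₂) ^ 1) +
              (-E₀₀ / 16) * ((k₁.divisors.card : ℝ) * ((k₂.divisors.card : ℝ) *
                (3 * (∑ p ∈ k₂.primeFactors, Real.log p ^ 2) ^ 2 - 2 * ∑ p ∈ k₂.primeFactors, Real.log p ^ 4)) *
                (2 * (lam * Real.log M) - 2 * Real.log g - Real.log k₁ - Real.log k₂) ^ 0)) -
        (fun (lam : ℝ) (P : ℝ[X]) ↦ (π ^ 2 / 6) ^ 2 * ((∑ j ∈ Finset.range (5 + 1), ∑ i ∈ Finset.range (j + 1),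
            ((5 : ℕ).choose j : ℝ) * (j.choose i : ℝ) * 2 ^ (5 - j) *
              ∫ u in (0 : ℝ)..1, (((Polynomial.C lam - X) ^ (5 - j) * derivative (derivative (X ^ i * P))) *
                derivative (derivative (X ^ (j - i) * P))).eval u) / 160 -
          3 / 16 * (∑ j ∈ Finset.range (1 + 1), ∑ i ∈ Finset.range (j + 1),
            ((1 : ℕ).choose j : ℝ) * (j.choose i : ℝ) * 2 ^ (1 - j) *
              ∫ u in (0 : ℝ)..1, (((Polynomial.C lam - X) ^ (1 - j) * (-(2 : ℝ) • (X ^ i * P))) *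
                (-(2 : ℝ) • (X ^ (j - i) * P))).eval u))) lam P * Real.log M ^ 2| ≤ C * Real.log M := by
  intro P hP0 hP1 lam hlam0 hlam1 E₀₀ E₀₁ E₀₂ E₀₃ E₁₀ E₁₁ E₁₂ E₁₃ μ₂ μ₄
  exact abs_selbergOrderOneThreePoly_sub_le P hP0 hP1 hlam0 hlam1 E₀₀ E₀₁ E₀₂ E₀₃ E₁₀ E₁₁ E₁₂ E₁₃ μ₂ μ₄

end Summit.Parity.GeneralizedHardyLittlewood.Theorems.MomentsBeyondDiagonal.DiagKernel

end
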